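import Summits.BirchSwinnertonDyer.BirchSwinnertonDyer.Theses.CompanionSqueezeDoorRankTwo
import HarnessLib

/-!
# BirchSwinnertonDyer / CompanionSqueezeDoorRankTwo — the assembly item (stmt-BirchSwinnertonDyer-23778)

Route `route-BirchSwinnertonDyer-CompanionSqueezeDoorRankTwo` (D-0145 ideator line bsd-idea-4 #4;
director-bsd W-62: T-tier DOOR target «T-r2C»/«T-r2Sha»; tribunal r1 PASSED 2026-08-28T00:24Z,
T1: "Assembly 23778 provable now — cell please close"). The assembly item is the chain
`CompanionSqueezeSupply → PublishedInputsCompanion → CompanionSqueezeKernel → InfinitelyManyRankTwoShaPTrivial`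
(with the ORIGINAL supply `CompanionSqueezeSupply`, kept as a plain definition after the re-type to
`CompanionSqueezeSupplyR`; the kernel does not use the companion isomorphism, so the same squeeze
applies): on each member `(W₁, W₂)` of the supply the kernel gives `rank W₁ = 2`, `Ш(W₁)[p] = 0`,
`corank_p Ш(W₁) = 0`, `corank Sel_{p^∞}(W₁) = 2`, `r_an(W₁) ≥ 2`; `Set.Infinite.mono` transports
infinitude of discriminants — the route's deciding theorem `closes` verbatim up to the dropped
isomorphism clause.

This is a DOOR route: nothing here proves a class theorem at rank `≥ 2`, and BSD is NOT proved by it.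
PARTITION: none — r_an ≥ 2, summit axis S0; TWIN (D-0056): n/a. B1 honesty: term-level glue only.
-/

set_option linter.dupNamespace false

namespace Summit.BirchSwinnertonDyer.BirchSwinnertonDyer.Theorems

open Summit.BirchSwinnertonDyer.BirchSwinnertonDyer.Theses.CompanionSqueezeDoorRankTwo

/-- **The assembly item of route `CompanionSqueezeDoorRankTwo` holds** (stmt-BirchSwinnertonDyer-23778
`Assembly`): the companion-squeeze supply, the published inputs and the squeeze kernel imply the
route-local leaf `InfinitelyManyRankTwoShaPTrivial` (the kernel applied member-wise, then
`Set.Infinite.mono`). [cite: Wuthrich2014, Prop. 21 (p. 400)] [cite: MazurRubin2012, Thm. 3.1] -/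
theorem companionSqueezeDoorRankTwo_assembly_proof :
    Summit.BirchSwinnertonDyer.BirchSwinnertonDyer.Theses.CompanionSqueezeDoorRankTwo.Assembly := by
  unfold Summit.BirchSwinnertonDyer.BirchSwinnertonDyer.Theses.CompanionSqueezeDoorRankTwo.Assembly
  intro hS hIn hK
  obtain ⟨p, hp, h5, hInf⟩ := hS
  refine ⟨p, hp, h5, ?_⟩
  refine Set.Infinite.mono ?_ hInf
  rintro Δ ⟨W₁, W₂, h₁, h₁m, h₂, h₂m, hΔ, hpair⟩
  obtain ⟨hr, hsha, hco, hsel, han⟩ := hK hIn p h5 W₁ W₂ hpair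
  exact ⟨W₁, h₁, h₁m, hΔ, hr, hsha, hco, hsel, han⟩

end Summit.BirchSwinnertonDyer.BirchSwinnertonDyer.Theorems
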